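import Literature.Computability.Complexity.ExtMonotoneCircuits
import Literature.Computability.Complexity.CliqueTestGraphs
import Mathlib.Algebra.Order.Star.Real

/-!
# `CLIQUE(m, k)` is ONE unbounded-width LP gate (feasibility form of a weak MLP gate)

For the extended monotone gate classes of `ExtMonotoneGates.lean` (CONV = monotone
SDP-feasibility gates in the sense of Oliveira–Pudlák 2019, Def. 3.1, `B ≥ 0`; basis
`extGate s = {∧₂, ∨₂} ∪ CONV_s ∪ PERM_s ∪ GRANK_s` of route PneNP/ConvexRankGates) this file
PROVES the folklore upper bound that every DNF is one LP-feasibility gate, for the clique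
function: for EVERY `m, k`, `CLIQUE(m, k) = cliqueFn m k` is computed by a circuit with ONE gate,
a CONV gate of width `lpWidth m k = C(m,k) · #E(K_m) + 1 + C(m,k)` — variables `Y ⪰ 0` of
dimension `C(m,k)` (one diagonal slot per `k`-set `T`), constraints `tr Y ≥ 1` and
`Y_TT ≤ [x_e]` for every `k`-set `T` and every edge `e ⊆ T` (`B ∈ {0,1}`, so `B ≥ 0`). If `T` is
a clique, `Y = E_TT` is feasible; if `Y` is feasible some diagonal entry is positive and the
constraints switch on every edge inside that `T`.

It is the positive construction behind the load-bearing analysis of the crux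
`CliqueExtLowerBound` (stmt-PneNP-10682; standing disprover's `Disproof.lean`): the width bound
`p + q ≤ m^c`, the growth `⌈m^δ⌉₊ → ∞`, the gap `m - ⌈m^δ⌉₊ → ∞` and the quantifier order
`∀ c, ∀ᶠ m` of that crux are each necessary, because `lpWidth m k ≤ m^{j+3}` as soon as
`C(m,k) ≤ m^j`.

* `isNClique_cliqueGraph_iff`, `cliqueFn_eq_true_iff_exists` — cliques through edge indicators;
* `cliqueGate_isConvGate` — the LP gate; `exists_oneConvGate_computes`,
  `exists_oneGate_extGate_computes` — as size-1 circuits over CONV / `extGate s`, `s ≥ lpWidth`;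
* `lpWidth_eq`, `lpWidth_le_of_choose_le`, `lpWidth_le` — width bookkeeping.

NOT here: any lower bound; the LP-lift question for `k = m^δ` (open, Oliveira–Pudlák 2019, p. 3).

References: M. de Oliveira Oliveira, P. Pudlák, *Representations of monotone Boolean functions
by linear programs*, ACM Trans. Comput. Theory 11 (2019), Def. 3.1 (weak MLP gates, `B ≥ 0`
guarantees monotonicity) [OliveiraPudlak2019]; S. Jukna, *Boolean Function Complexity* (2012),
§9.1 (the clique function, positive test graphs) [Jukna2012].
-/

open Literature.Computability.Complexity Filter Finset Matrix

namespace Literature.Computability.Complexity.CliqueLPGate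

/-! ### 1. Cliques through edge indicators -/

variable {m : ℕ}

/-- `S` is a `k`-clique of the graph spanned by `x` iff `#S = k` and every edge of `K_m` inside
`S` is switched on. [folklore] -/
theorem isNClique_cliqueGraph_iff (x : (⊤ : SimpleGraph (Fin m)).edgeSet → Bool) (k : ℕ)
    (S : Finset (Fin m)) :
    (cliqueGraph x).IsNClique k S ↔
      S.card = k ∧
        ∀ e : (⊤ : SimpleGraph (Fin m)).edgeSet, (∀ y ∈ (e : Sym2 (Fin m)), y ∈ S) → x e = true := by
  rw [SimpleGraph.isNClique_iff, SimpleGraph.isClique_iff, and_comm]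
  refine and_congr_right fun _ => ⟨fun hcl => ?_, fun h => ?_⟩
  · rintro ⟨e, he⟩ hin
    induction e using Sym2.ind with
    | h u w =>
      have hne : u ≠ w := (SimpleGraph.top_adj u w).1 ((SimpleGraph.mem_edgeSet ⊤).1 he)
      have hu : u ∈ S := hin u (Sym2.mem_mk_left u w)
      have hw : w ∈ S := hin w (Sym2.mem_mk_right u w)
      obtain ⟨_, hx⟩ := (cliqueGraph_adj x u w).1 (hcl hu hw hne)
      exact hx
  · intro u hu w hw hne
    refine (cliqueGraph_adj x u w).2 ⟨hne, h _ ?_⟩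
    intro y hy
    rcases Sym2.mem_iff.1 hy with rfl | rfl
    · exact hu
    · exact hw

/-- `CLIQUE(m,k)(x) = 1` iff some `k`-set of vertices has all its edges switched on. [folklore] -/
theorem cliqueFn_eq_true_iff_exists (k : ℕ) (x : (⊤ : SimpleGraph (Fin m)).edgeSet → Bool) :
    cliqueFn m k x = true ↔
      ∃ S : Finset (Fin m), S.card = k ∧
        ∀ e : (⊤ : SimpleGraph (Fin m)).edgeSet, (∀ y ∈ (e : Sym2 (Fin m)), y ∈ S) → x e = true := by
  simp only [cliqueFn_eq_true_iff, SimpleGraph.CliqueFree, not_forall, not_not,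
    isNClique_cliqueGraph_iff]

/-! ### 2. ONE unbounded-width LP gate computes `CLIQUE(m, k)` -/

section LPGate

variable (m k : ℕ)

/-- Number of edge variables `#E(K_m)`. [folklore] -/
noncomputable def nE (m : ℕ) : ℕ := Fintype.card (⊤ : SimpleGraph (Fin m)).edgeSet

/-- An enumeration of the edge variables. [folklore] -/
noncomputable def eE (m : ℕ) : (⊤ : SimpleGraph (Fin m)).edgeSet ≃ Fin (nE m) :=
  Fintype.equivFin _

/-- The `k`-subsets of the vertex set. [folklore] -/
abbrev KSub (m k : ℕ) : Type := {S : Finset (Fin m) // S.card = k}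

/-- Number of `k`-subsets, `= m.choose k` (`nK_eq`). [folklore] -/
noncomputable def nK (m k : ℕ) : ℕ := Fintype.card (KSub m k)

/-- An enumeration of the `k`-subsets. [folklore] -/
noncomputable def eK (m k : ℕ) : KSub m k ≃ Fin (nK m k) := Fintype.equivFin _

/-- `nK m k = C(m, k)`. [folklore] -/
theorem nK_eq : nK m k = m.choose k := by
  simp [nK, KSub, Fintype.card_finset_len]

/-- `nE m ≤ m ^ 2`. [folklore] -/
theorem nE_le : nE m ≤ m ^ 2 := by
  calc nE m ≤ Fintype.card (Sym2 (Fin m)) :=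
        Fintype.card_le_of_injective Subtype.val Subtype.val_injective
    _ ≤ Fintype.card (Fin m × Fin m) :=
        Fintype.card_le_of_surjective (Sym2.mk (α := Fin m)).uncurry Sym2.mk_surjective
    _ = m ^ 2 := by simp [sq]

/-- The clique function as a gate function of arity `#E(K_m)` (inputs enumerated by `eE`).
[folklore] -/
noncomputable def cliqueGate : GateFn := ⟨nE m, fun v => cliqueFn m k fun e => v (eE m e)⟩

/-- The width of the LP gate below: `p + q` with `q = C(m,k)` variables and
`p = 1 + C(m,k) · #E(K_m)` constraints. [folklore] -/
noncomputable def lpWidth : ℕ := Fintype.card (Option (Fin (nK m k) × Fin (nE m))) + nK m k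

/-- `lpWidth m k = (C(m,k) · #E + 1) + C(m,k)`. [folklore] -/
theorem lpWidth_eq : lpWidth m k = m.choose k * nE m + 1 + m.choose k := by
  simp [lpWidth, Fintype.card_option, Fintype.card_prod, Fintype.card_fin, nK_eq]

/-- **`CLIQUE(m,k)` is ONE CONV gate of width `lpWidth m k`** (an LP in SDP clothing; gate model
of Oliveira–Pudlák 2019, Def. 3.1, feasibility form): variables `Y ⪰ 0` of dimension `q = C(m,k)`
(one diagonal slot per `k`-set `T`), constraints `tr Y ≥ 1` and `Y_TT ≤ [x_e]` for every `k`-set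
`T` and every edge `e` inside `T` (`B ∈ {0,1}`, so `B ≥ 0`). If `T` is a clique, `Y = E_TT` is
feasible; if `Y` is feasible some diagonal entry is positive (`tr Y ≥ 1`, `Y ⪰ 0`) and the
constraints switch on every edge inside that `T` — the LP `y_T ≥ 0, ∑ y_T ≥ 1, y_T ≤ x_e` of the
DNF of CLIQUE. [folklore] -/
theorem cliqueGate_isConvGate : IsConvGate (lpWidth m k) (cliqueGate m k) := by
  classical
  -- data
  let S : Fin (nK m k) → Finset (Fin m) := fun KK => ((eK m k).symm KK).1
  have hS : ∀ KK, (S KK).card = k := fun KK => ((eK m k).symm KK).2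
  let eP := Fintype.equivFin (Option (Fin (nK m k) × Fin (nE m)))
  let A : Fin (Fintype.card (Option (Fin (nK m k) × Fin (nE m)))) →
      Matrix (Fin (nK m k)) (Fin (nK m k)) ℝ := fun i =>
    (eP.symm i).elim (-1) fun x =>
      if (∀ y ∈ (((eE m).symm x.2 : (⊤ : SimpleGraph (Fin m)).edgeSet) : Sym2 (Fin m)), y ∈ S x.1)
        then Matrix.single x.1 x.1 1 else 0
  let b : Fin (Fintype.card (Option (Fin (nK m k) × Fin (nE m)))) → ℝ := fun i =>
    (eP.symm i).elim (-1) fun _ => 0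
  let B : Fin (Fintype.card (Option (Fin (nK m k) × Fin (nE m)))) → Fin (nE m) → ℝ := fun i j' =>
    (eP.symm i).elim 0 fun x => if j' = x.2 then 1 else 0
  refine ⟨_, nK m k, le_rfl, A, b, B, ?_, ?_⟩
  · -- `B ≥ 0`
    intro i j'
    simp only [B]
    cases eP.symm i with
    | none => simp
    | some x =>
      simp only [Option.elim_some]
      split_ifs <;> norm_num
  · show ∀ v : Fin (nE m) → Bool, cliqueFn m k (fun e => v (eE m e)) = true ↔
      ∃ Y : Matrix (Fin (nK m k)) (Fin (nK m k)) ℝ, Y.PosSemidef ∧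
        ∀ i, (A i * Y).trace ≤ b i + ∑ j : Fin (nE m), B i j * (if v j then (1 : ℝ) else 0)
    intro v
    rw [cliqueFn_eq_true_iff_exists]
    -- the right-hand sides of the edge constraints
    have hsum : ∀ j : Fin (nE m),
        (∑ j', (if j' = j then (1 : ℝ) else 0) * (if v j' then (1 : ℝ) else 0)) =
          if v j then 1 else 0 := fun j => by
      rw [Finset.sum_eq_single j (fun j' _ hne => by rw [if_neg hne, zero_mul])
        (fun h => absurd (Finset.mem_univ j) h), if_pos rfl, one_mul]
    have hind : ∀ j : Fin (nE m), (0 : ℝ) ≤ if v j then 1 else 0 := fun j => by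
      split_ifs <;> norm_num
    constructor
    · -- a clique `T` gives the feasible point `Y = E_TT`
      rintro ⟨T, hT, hx⟩
      let KK₀ : Fin (nK m k) := eK m k ⟨T, hT⟩
      have hSKK₀ : S KK₀ = T := by simp [S, KK₀]
      refine ⟨Matrix.single KK₀ KK₀ 1, ?_, fun i => ?_⟩
      · rw [← Matrix.diagonal_single]
        exact Matrix.PosSemidef.diagonal fun KK => by
          simp only [Pi.single_apply, Pi.zero_apply]
          split_ifs <;> norm_num
      · obtain ⟨o, rfl⟩ := eP.surjective i
        rcases o with _ | ⟨KK, j⟩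
        · simp only [A, b, B, Equiv.symm_apply_apply, Option.elim_none]
          simp [Matrix.trace_single_eq_same]
        · simp only [A, b, B, Equiv.symm_apply_apply, Option.elim_some]
          rw [hsum j, zero_add]
          by_cases hin : ∀ y ∈ (((eE m).symm j : (⊤ : SimpleGraph (Fin m)).edgeSet) :
              Sym2 (Fin m)), y ∈ S KK
          · rw [if_pos hin, Matrix.trace_single_mul, smul_eq_mul, one_mul, Matrix.single_apply]
            by_cases hKK : KK₀ = KK
            · -- the edge `j` lies inside `T`, hence is on
              subst hKK
              have hj : v j = true := by
                have := hx ((eE m).symm j) (hSKK₀ ▸ hin)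
                simpa using this
              rw [if_pos ⟨rfl, rfl⟩, hj, if_pos rfl]
            · rw [if_neg (fun h => hKK h.1)]
              exact hind j
          · rw [if_neg hin, Matrix.zero_mul, Matrix.trace_zero]
            exact hind j
    · -- a feasible `Y` has a positive diagonal slot, whose `k`-set is a clique
      rintro ⟨Y, hY, hc⟩
      have h1 : 1 ≤ Y.trace := by
        have h0 : ((-1 : Matrix _ _ ℝ) * Y).trace ≤ -1 + ∑ j', (0 : ℝ) * (if v j' then (1 : ℝ) else 0) := by
          have := hc (eP none)
          simp only [A, b, B, Equiv.symm_apply_apply, Option.elim_none] at this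
          exact this
        simp only [neg_mul, one_mul, Matrix.trace_neg, zero_mul, Finset.sum_const_zero,
          add_zero] at h0
        linarith
      obtain ⟨KK₀, hpos⟩ : ∃ KK, 0 < Y KK KK := by
        by_contra hneg
        have hle : ∀ KK, Y KK KK ≤ 0 := fun KK => not_lt.1 fun h => hneg ⟨KK, h⟩
        have : Y.trace ≤ 0 := Finset.sum_nonpos fun KK _ => hle KK
        linarith
      refine ⟨S KK₀, hS KK₀, fun e hin => ?_⟩
      have h2 : ((if (∀ y ∈ (e : Sym2 (Fin m)), y ∈ S KK₀) then Matrix.single KK₀ KK₀ 1 else 0 :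
            Matrix _ _ ℝ) * Y).trace ≤
          0 + ∑ j', (if j' = eE m e then (1 : ℝ) else 0) * (if v j' then (1 : ℝ) else 0) := by
        have := hc (eP (some (KK₀, eE m e)))
        simp only [A, b, B, Equiv.symm_apply_apply, Option.elim_some] at this
        exact this
      rw [if_pos hin, Matrix.trace_single_mul, smul_eq_mul, one_mul, zero_add, hsum] at h2
      cases hv : v (eE m e)
      · rw [hv] at h2
        simp only [Bool.false_eq_true, if_false] at h2
        linarith
      · rfl

/-- **One LP gate suffices**: for every `m, k` there is a circuit with ONE gate, a CONV gate of
width `lpWidth m k`, computing `CLIQUE(m, k)`. [folklore] -/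
theorem exists_oneConvGate_computes (m k : ℕ) :
    ∃ C : Circuit ((⊤ : SimpleGraph (Fin m)).edgeSet),
      C.IsOver {g | IsConvGate (lpWidth m k) g} ∧ C.size ≤ 1 ∧ C.Computes (cliqueFn m k) := by
  obtain ⟨C, hC, hs, he⟩ := (CktSize.gate (B := {g | IsConvGate (lpWidth m k) g})
    (cliqueGate m k) (cliqueGate_isConvGate m k) (fun a => (eE m).symm a)).toCircuit
  refine ⟨C, hC, hs, fun x => ?_⟩
  rw [he x]
  show cliqueFn m k (fun e => x ((eE m).symm (eE m e))) = cliqueFn m k x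
  simp

/-- The same circuit is a `B_s`-circuit for every `s ≥ lpWidth m k`. [folklore] -/
theorem exists_oneGate_extGate_computes (m k : ℕ) {s : ℕ} (hs : lpWidth m k ≤ s) :
    ∃ C : Circuit ((⊤ : SimpleGraph (Fin m)).edgeSet),
      C.IsOver (extGate s) ∧ C.size ≤ 1 ∧ C.Computes (cliqueFn m k) := by
  obtain ⟨C, hC, h1, hc⟩ := exists_oneConvGate_computes m k
  exact ⟨C, hC.mono fun g hg => (IsConvGate.mono hg hs).mem_extGate, h1, hc⟩

/-- Width bookkeeping: `lpWidth m k ≤ m ^ (j + 3)` as soon as `C(m,k) ≤ m ^ j` and `m ≥ 3`.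
[folklore] -/
theorem lpWidth_le_of_choose_le (m k j : ℕ) (hm : 3 ≤ m) (hq : m.choose k ≤ m ^ j) :
    lpWidth m k ≤ m ^ (j + 3) := by
  have h1 : 1 ≤ m := le_trans (by norm_num) hm
  have hn : nE m ≤ m ^ 2 := nE_le m
  rw [lpWidth_eq]
  calc m.choose k * nE m + 1 + m.choose k
      ≤ m ^ j * m ^ 2 + m ^ (j + 2) + m ^ (j + 2) := by
        have : 1 ≤ m ^ (j + 2) := Nat.one_le_pow _ _ h1
        have : m ^ j ≤ m ^ (j + 2) := Nat.pow_le_pow_right h1 (by omega)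
        have : m.choose k * nE m ≤ m ^ j * m ^ 2 := Nat.mul_le_mul hq hn
        omega
    _ = 3 * m ^ (j + 2) := by ring
    _ ≤ m * m ^ (j + 2) := Nat.mul_le_mul_right _ hm
    _ = m ^ (j + 3) := by ring

/-- In particular `lpWidth m k ≤ m ^ (k + 3)` for `m ≥ 3` (`C(m,k) ≤ m^k`). [folklore] -/
theorem lpWidth_le (m k : ℕ) (hm : 3 ≤ m) : lpWidth m k ≤ m ^ (k + 3) :=
  lpWidth_le_of_choose_le m k k hm (Nat.choose_le_pow m k)

end LPGate

end Literature.Computability.Complexity.CliqueLPGate
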